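import Summits.BirchSwinnertonDyer.BirchSwinnertonDyer.Theorems.EdixhovenFibreFiveSevenStarredOptimalManinUnitFiveSevenCellsOfRecTowerAt
import Summits.BirchSwinnertonDyer.BirchSwinnertonDyer.Theorems.EdixhovenFibreFiveSevenStarredOptimalManinUnitFiveSevenCellDataOfIsogenous
import HarnessLib

/-!
# K★ ⟸ {P1-bar, DD, [REC-tower] INTRINSICALLY at the K★ cells' cyclotomic towers} (route `EdixhovenFibreFiveSeven`, crux K★
# stmt-BirchSwinnertonDyer-22226, line `kato-lever`; seat `bsd-line-edix-p1` g29, LEAD)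

HONEST FRAMING. TOOL theorems only (no definition, no named fact, no `sorry`; file-local instance keys on `ℚ_v` byte-identical to
`…CellsOfRecTowerAt` l.73–77); nothing is closed or booked; K★ stays OPEN; BSD is NOT proved by any of this. Sequel of `…CellsOfRecTowerAt`
(memo `Cruxes/StarredOptimalManinUnitFiveSeven/Lines/kato-lever-seam-rec-at-cells.md` §5 «ISOGENY»).

WHY. The stubs of skeleton v7 (`hRECord` / `hRECss` of `…CellsOfRecTowerAt`) ask Kato's reciprocity law for every MEMBER `W′ ∼ W` of the isogeny
class of a cell curve `W` (P1-bar's member is only known up to isogeny), but the line constructs it curve-by-curve from an explicit `𝒪_D`-model,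
i.e. from the CELL DATA of the curve itself. This file makes the stubs INTRINSIC — `hRECordI` / `hRECssI`: the [REC-tower] body for every globally
minimal `W′/ℚ` that ITSELF satisfies the cell conditions (`Addv`, `Irr`, no `Iₙ*`, `4 < ord_p Δ_min`, the selector) — and moves the cell data from
`W` to the member `W′` inside the closer: `Addv` (`X2.addv_iff_of_isIsogenous`), `Irr` (`X12.irr_iff_of_isIsogenous`), no `Iₙ*`
(`MemberManinUnitFiveSevenGlue.forall_ne_Istar_of_isIsogenous`), and `ord_p Δ_min` by Dokchitser–Dokchitser 2015 Thm. 5.1 (1) (`hDD`, the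
cite-only fact `dokchitser_padicValInt_minimalDiscriminantInt_eq_of_isogeny_of_not_dvd_degree`, already a conjunct of this route's
`PublishedManinFacts` / `KPTransportInputs`) along a cyclic isogeny of degree prime to `p` (`Irr`, `X11b.not_dvd_degree_of_isCyclic_of_irr`;
`0 ≤ ord_p j` from `padicValRat_j_nonneg_of_forall_ne_Istar`) — the G57 pattern of `exists_member_not_dvd_c_of_four_lt`.

* ★★ `starredOptimalManinUnit_ordinaryCells_of_recTowerAtIntrinsic`, ★★ `…_supersingularCells_…`,
  ★★★ `starredOptimalManinUnitFiveSeven_of_recTowerAtIntrinsic : hRECordI → hRECssI → hDD → P1-bar → K★` (composition of skeleton v8).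

References: [Kato1993LNM1553] Ch. II §1.2.4, Thm. 1.4.1 (3)–(4); [Kato2004Asterisque] (8.1.3), Thm. 9.7, Thm. 6.6 (1);
[DokchitserDokchitser2015LocalInvariants] Thm. 5.1 (1); [EdixhovenManin1991] Thm. 3; [KostersPannekoek2017] Thm. 1.
-/

set_option autoImplicit false
-- the Theorems namespace of a single-conjunct summit repeats the summit name by design (D-0017)
set_option linter.dupNamespace false

noncomputable section

open scoped Classical MatrixGroups NumberField NNReal

open WeierstrassCurve NumberField IsDedekindDomain Field ValuativeRel
  Literature.NumberTheory.EllipticCurves Literature.NumberTheory.EllipticCurves.ModularForms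
  Literature.NumberTheory.EllipticCurves.Rank1Residual Literature.NumberTheory.EllipticCurves.Kato2004
  Literature.NumberTheory.DiophantineGeometry Rat.HeightOneSpectrum
  Literature.NumberTheory.PAdicHodge Literature.NumberTheory.GaloisRepresentations
  Literature.NumberTheory.GaloisRepresentations.IsNonarchimedeanLocalField
  Literature.NumberTheory.GaloisRepresentations.PeriodRingData
  Summit.BirchSwinnertonDyer.Rank1Residual Summit.BirchSwinnertonDyer.Rank1Residual.Additive
  Summit.BirchSwinnertonDyer.Rank1Residual.GaloisImage
  Summit.BirchSwinnertonDyer.BirchSwinnertonDyer.Theorems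
  Summit.BirchSwinnertonDyer.BirchSwinnertonDyer.Theorems.KatoAssemblySocketAt
  Summit.BirchSwinnertonDyer.BirchSwinnertonDyer.Theorems.ManinFrameResidueProperRTameTwistAt
  Summit.BirchSwinnertonDyer.BirchSwinnertonDyer.Theorems.StarredOptimalManinUnitFiveSevenSupersingularCellsExplicit
  Summit.BirchSwinnertonDyer.BirchSwinnertonDyer.Theorems.StarredOptimalManinUnitFiveSevenCellsOfSL2NeronValuesBar
  Summit.BirchSwinnertonDyer.BirchSwinnertonDyer.Theorems.StarredOptimalManinUnitFiveSevenAssemblyAtBarOfRangeAt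
  Summit.BirchSwinnertonDyer.BirchSwinnertonDyer.Theorems.KimAtThreeDeepLowerExpStarOmega
  Summit.BirchSwinnertonDyer.BirchSwinnertonDyer.Theorems.KimAtThreeDeepLowerExpStarOmegaPlace
  Summit.BirchSwinnertonDyer.BirchSwinnertonDyer.Theorems.KimAtThreeDeepLowerExpStarOmegaRes
  Summit.BirchSwinnertonDyer.BirchSwinnertonDyer.Theorems.KimAtThreeDeepUpperExpStarTransport
  Summit.BirchSwinnertonDyer.BirchSwinnertonDyer.Theorems.KimAtThreeDeepUpperExpStarFacts
  Summit.BirchSwinnertonDyer.BirchSwinnertonDyer.Theorems.KimAtThreeDeepUpperExpStarFactsCanonical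
open Summit.BirchSwinnertonDyer.BirchSwinnertonDyer.Theorems.KimAtThreeDeepUpperTowerLattice (fact_natCast_mem_primesEquiv_symm)
open Literature.NumberTheory.EllipticCurves.FormalGroupChart (padicLogPointFiniteExt)
open CategoryTheory
open Summit.BirchSwinnertonDyer.BirchSwinnertonDyer.Theorems.StarredOptimalManinUnitFiveSevenRecTowerAtBridge
open Summit.BirchSwinnertonDyer.BirchSwinnertonDyer.Theorems.StarredOptimalManinUnitFiveSevenCellsOfRecTowerAt

namespace Summit.BirchSwinnertonDyer.BirchSwinnertonDyer.Theorems.StarredOptimalManinUnitFiveSevenCellsOfRecTowerAtIntrinsic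

-- FILE-LOCAL instance keys, byte-identical to the accepted `…SemiLocalIntegralityPinAt.lean` l.164–169 (no library instance is
-- overridden outside this file): the `Fact (p ∈ v_p)` key and the local-field structures on `ℚ_v = Place.Completion (inr v)`, under
-- which the bodies of (S5b-tower) / [REC-tower] at `ℚ_v ⊆ L` are stated.
attribute [local instance] fact_natCast_mem_primesEquiv_symm
attribute [local instance 100000] NumberField.Place.instAlgebraCompletion
attribute [local instance] valuativeRelPlace topologicalSpacePlace
attribute [local instance] isNonarchimedeanLocalField_place charZero_place
attribute [local instance] padicAlgebraPlace fact_not_isUnit_place isAdicComplete_place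

/-! ## §1 The K★ cell closers, GRANTED P1-bar, DD and [REC-tower] INTRINSICALLY AT THE CELLS -/

section Cells

/-- ★★ **K★ on the three (G)-ORDINARY starred cells `(5; III*), (7; IV*), (7; II*)` GRANTED ONLY P1-bar and [REC-tower] AT THE CELLS' TOWERS.**
`…CellsOfSL2NeronValuesBar.starredOptimalManinUnit_ordinaryCells_of_sl2NeronValuesBar` VERBATIM (for `W/ℚ` globally minimal, `p ∈ {5, 7}`,
additive at `p`, `E[p]` irreducible, no `Iₙ*` fibre at `p`, `4 < ord_p Δ_min`, on the half `p = 5 ↔ ord_p Δ_min = 9`, and `D` lattice-optimal at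
the conductor level: `p ∤ c(D)`), with the ∀-fields cite fact hT₂ replaced by `hRECordI` — the body of Kato's reciprocity law [REC-tower] for every globally minimal curve `W′`
IN THE CELL (intrinsic cell conditions on `W′`; no isogeny) at every tower `ℚ_v ⊆ ℚ(ζ_m)_w`, `p ∤ m` — and Dokchitser–Dokchitser 2015 Thm. 5.1 (1)
`hDD` (cite-only, already a conjunct of this route's `PublishedManinFacts`/`KPTransportInputs`), which moves the cell data to Kato's member `W′ ∼ W`
(prime-to-`p` cyclic isogeny by `Irr`, `X11b.not_dvd_degree_of_isCyclic_of_irr`). Proof: the original's, with the F″ body read through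
`…AssemblyAtBarOfRangeAt.katoNeronBody_of_sl2NeronValuesBar_of_rangeAt`, whose `hT₂V` is `rangeAt_of_recTowerAt ∘ hRECordI`. CONDITIONAL on
P1-bar (cite-only) and the displayed `hRECordI`; nothing is closed. [cite: Kato2004Asterisque, (8.1.3) (p. 180), Thm. 9.7 (p. 189)]
[cite: Kato1993LNM1553, Ch. II Thm. 1.4.1 (3)–(4)] [cite: KimNakamura2020, Cor. 2.4] [cite: KostersPannekoek2017, Thm. 1]
[cite: DokchitserDokchitser2015LocalInvariants, Thm. 3.2] -/
theorem starredOptimalManinUnit_ordinaryCells_of_recTowerAtIntrinsic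
    (hRECordI : ∀ (W' : WeierstrassCurve ℚ) [W'.IsElliptic] [W'.IsGloballyMinimal] (p : ℕ) [hp : Fact p.Prime], (p = 5 ∨ p = 7) → Addv W' p → Irr W' p →
      (∀ (v : HeightOneSpectrum ℤ) (n : ℕ), natGenerator v = p → W'.kodairaSymbolAt v ≠ KodairaSymbol.Istar n) →
      4 < padicValInt p W'.minimalDiscriminantInt → (p = 5 ↔ padicValInt p W'.minimalDiscriminantInt = 9) → ∀ (m : ℕ) [NeZero m], ¬ p ∣ m →
      ∀ (w : ((primesEquiv (R := 𝓞 ℚ)).symm ⟨p, hp.out⟩).Extension (𝓞 (CyclotomicField m ℚ))) (hw : ((p : ℕ) : 𝓞 (CyclotomicField m ℚ)) ∈ w.1.asIdeal)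
      [CharZero (w.1.adicCompletion (CyclotomicField m ℚ))] [Fact (¬ IsUnit ((p : ℕ) : integerC (w.1.adicCompletion (CyclotomicField m ℚ))))]
      [IsAdicComplete (Ideal.span {((p : ℕ) : integerC (w.1.adicCompletion (CyclotomicField m ℚ)))}) (integerC (w.1.adicCompletion (CyclotomicField m ℚ)))]
      (hL : valuation (w.1.adicCompletion (CyclotomicField m ℚ)) ((p : ℕ) : (w.1.adicCompletion (CyclotomicField m ℚ))) < 1), letI := LocalField.adicCompletionPadicAlgebra w.1 p hw
      letI : Algebra (Place.Completion (K := ℚ) (Sum.inr ((primesEquiv (R := 𝓞 ℚ)).symm ⟨p, hp.out⟩))) (w.1.adicCompletion (CyclotomicField m ℚ)) :=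
      inferInstanceAs (Algebra (((primesEquiv (R := 𝓞 ℚ)).symm ⟨p, hp.out⟩).adicCompletion ℚ) (w.1.adicCompletion (CyclotomicField m ℚ)))
      ∀ (wv : Valuation (Place.Completion (Sum.inr ((primesEquiv (R := 𝓞 ℚ)).symm ⟨p, hp.out⟩) : Place ℚ)) ℝ≥0) [wv.Compatible]
      [(W'.baseChange (Place.Completion (Sum.inr ((primesEquiv (R := 𝓞 ℚ)).symm ⟨p, hp.out⟩) : Place ℚ))).IsIntegral wv.integer]
      (ν : Valuation (w.1.adicCompletion (CyclotomicField m ℚ)) ℝ≥0) [ν.Compatible] [(W'.baseChange (w.1.adicCompletion (CyclotomicField m ℚ))).IsIntegral ν.integer]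
      (e : (k : ℕ) → geomTorsion W' ((p ^ k : ℕ) : ℤ) → geomTorsion W' ((p ^ k : ℕ) : ℤ) → AlgebraicClosure ℚ) (hμ : ∀ k S T, e k S T ^ (p ^ k) = 1)
      (hadd₁ : ∀ k S₁ S₂ T, e k (S₁ + S₂) T = e k S₁ T * e k S₂ T) (hadd₂ : ∀ k S T₁ T₂, e k S (T₁ + T₂) = e k S T₁ * e k S T₂)
      (hgal : ∀ k (σ : absoluteGaloisGroup ℚ) (S T : geomTorsion W' ((p ^ k : ℕ) : ℤ)), σ • e k S T = e k (σ • S) (σ • T))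
      (_hnondeg : ∀ k (T : geomTorsion W' ((p ^ k : ℕ) : ℤ)), (∀ S, e k S T = 1) → T = 0) (hcompat : ∀ k (S T : geomTorsion W' ((p ^ (k + 1) : ℕ) : ℤ)),
      e k (torsionMulHom W' (p ^ (k + 1)) (p ^ k) p (pow_succ p k).symm S) (torsionMulHom W' (p ^ (k + 1)) (p ^ k) p (pow_succ p k).symm T) = e (k + 1) S T ^ p)
      (d₀ : LocalNeronLineAt W' p ((primesEquiv (R := 𝓞 ℚ)).symm ⟨p, hp.out⟩)) (d : LocalNeronLine W' hL ((galRestrictPlace ((primesEquiv (R := 𝓞 ℚ)).symm ⟨p, hp.out⟩)).comp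
      (absGaloisRestrict (Place.Completion (Sum.inr ((primesEquiv (R := 𝓞 ℚ)).symm ⟨p, hp.out⟩) : Place ℚ)) (w.1.adicCompletion (CyclotomicField m ℚ))))),
      (bdRPeriodRingData (valuation_place_lt_one p ((primesEquiv (R := 𝓞 ℚ)).symm ⟨p, hp.out⟩))).CupLogInjective (logCyclotomic p)
      (localRationalTateRep W' p (galRestrictPlace ((primesEquiv (R := 𝓞 ℚ)).symm ⟨p, hp.out⟩))) →
      (∀ z : contOneCocycles (localRationalTateRep W' p (galRestrictPlace ((primesEquiv (R := 𝓞 ℚ)).symm ⟨p, hp.out⟩))).toTopRep,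
      (bdRPeriodRingData (valuation_place_lt_one p ((primesEquiv (R := 𝓞 ℚ)).symm ⟨p, hp.out⟩))).HasDualExp (logCyclotomic p)
      (localRationalTateRep W' p (galRestrictPlace ((primesEquiv (R := 𝓞 ℚ)).symm ⟨p, hp.out⟩))) fun σ => z.1 σ) →
      (bdRPeriodRingData (F := (w.1.adicCompletion (CyclotomicField m ℚ))) (p := p) hL).CupLogInjective (logCyclotomic p) (localRationalTateRep W' p
      ((galRestrictPlace ((primesEquiv (R := 𝓞 ℚ)).symm ⟨p, hp.out⟩)).comp (absGaloisRestrict (Place.Completion (Sum.inr ((primesEquiv (R := 𝓞 ℚ)).symm ⟨p, hp.out⟩) : Place ℚ)) (w.1.adicCompletion (CyclotomicField m ℚ))))) →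
      (∀ z : contOneCocycles (localRationalTateRep W' p
      ((galRestrictPlace ((primesEquiv (R := 𝓞 ℚ)).symm ⟨p, hp.out⟩)).comp (absGaloisRestrict (Place.Completion (Sum.inr ((primesEquiv (R := 𝓞 ℚ)).symm ⟨p, hp.out⟩) : Place ℚ)) (w.1.adicCompletion (CyclotomicField m ℚ))))).toTopRep,
      (bdRPeriodRingData (F := (w.1.adicCompletion (CyclotomicField m ℚ))) (p := p) hL).HasDualExp (logCyclotomic p) (localRationalTateRep W' p
      ((galRestrictPlace ((primesEquiv (R := 𝓞 ℚ)).symm ⟨p, hp.out⟩)).comp (absGaloisRestrict (Place.Completion (Sum.inr ((primesEquiv (R := 𝓞 ℚ)).symm ⟨p, hp.out⟩) : Place ℚ)) (w.1.adicCompletion (CyclotomicField m ℚ)))))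
      fun σ => z.1 σ) → (∀ (η₀ : contOneCocycles (restrictedTateRep W' (Place.Completion (Sum.inr ((primesEquiv (R := 𝓞 ℚ)).symm ⟨p, hp.out⟩) : Place ℚ)) p).toTopRep)
      (ηT : contOneCocycles ((restrictedTateRep W' (Place.Completion (Sum.inr ((primesEquiv (R := 𝓞 ℚ)).symm ⟨p, hp.out⟩) : Place ℚ)) p).restrict
      (absGaloisRestrict (Place.Completion (Sum.inr ((primesEquiv (R := 𝓞 ℚ)).symm ⟨p, hp.out⟩) : Place ℚ)) (w.1.adicCompletion (CyclotomicField m ℚ)))).toTopRep),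
      (∀ σ, ηT.1 σ = η₀.1 (absGaloisRestrict (Place.Completion (Sum.inr ((primesEquiv (R := 𝓞 ℚ)).symm ⟨p, hp.out⟩) : Place ℚ)) (w.1.adicCompletion (CyclotomicField m ℚ)) σ)) →
      expStarCoordTower W' (F₀ := (Place.Completion (Sum.inr ((primesEquiv (R := 𝓞 ℚ)).symm ⟨p, hp.out⟩) : Place ℚ))) hL d ηT =
      algebraMap (Place.Completion (Sum.inr ((primesEquiv (R := 𝓞 ℚ)).symm ⟨p, hp.out⟩) : Place ℚ)) (w.1.adicCompletion (CyclotomicField m ℚ))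
      (expStarCoord W' (valuation_place_lt_one p ((primesEquiv (R := 𝓞 ℚ)).symm ⟨p, hp.out⟩)) d₀ η₀)) →
      ∃ c : (Place.Completion (Sum.inr ((primesEquiv (R := 𝓞 ℚ)).symm ⟨p, hp.out⟩) : Place ℚ)), c ≠ 0 ∧
      (∀ (η₀ : contOneCocycles (restrictedTateRep W' (Place.Completion (Sum.inr ((primesEquiv (R := 𝓞 ℚ)).symm ⟨p, hp.out⟩) : Place ℚ)) p).toTopRep)
      (P : (W'.baseChange (Place.Completion (Sum.inr ((primesEquiv (R := 𝓞 ℚ)).symm ⟨p, hp.out⟩) : Place ℚ))).toAffine.Point),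
      ((tatePairingPoint W' (Place.Completion (Sum.inr ((primesEquiv (R := 𝓞 ℚ)).symm ⟨p, hp.out⟩) : Place ℚ)) p e hμ hadd₁ hadd₂ hgal hcompat (oneCocycleClass _ η₀) P : ℤ_[p]) : ℚ_[p]) =
      Algebra.trace ℚ_[p] (Place.Completion (Sum.inr ((primesEquiv (R := 𝓞 ℚ)).symm ⟨p, hp.out⟩) : Place ℚ))
      (c * expStarCoord W' (valuation_place_lt_one p ((primesEquiv (R := 𝓞 ℚ)).symm ⟨p, hp.out⟩)) d₀ η₀ *
      padicLogPointFiniteExt wv (W'.baseChange (Place.Completion (Sum.inr ((primesEquiv (R := 𝓞 ℚ)).symm ⟨p, hp.out⟩) : Place ℚ))) p P)) ∧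
      (∀ (ηT : contOneCocycles ((restrictedTateRep W' (Place.Completion (Sum.inr ((primesEquiv (R := 𝓞 ℚ)).symm ⟨p, hp.out⟩) : Place ℚ)) p).restrict
      (absGaloisRestrict (Place.Completion (Sum.inr ((primesEquiv (R := 𝓞 ℚ)).symm ⟨p, hp.out⟩) : Place ℚ)) (w.1.adicCompletion (CyclotomicField m ℚ)))).toTopRep)
      (P : (W'.baseChange (w.1.adicCompletion (CyclotomicField m ℚ))).toAffine.Point),
      ((tatePairingPointTower W' (Place.Completion (Sum.inr ((primesEquiv (R := 𝓞 ℚ)).symm ⟨p, hp.out⟩) : Place ℚ)) e hμ hadd₁ hadd₂ hgal hcompat (oneCocycleClass _ ηT) P : ℤ_[p]) : ℚ_[p]) =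
      Algebra.trace ℚ_[p] (w.1.adicCompletion (CyclotomicField m ℚ))
      (algebraMap (Place.Completion (Sum.inr ((primesEquiv (R := 𝓞 ℚ)).symm ⟨p, hp.out⟩) : Place ℚ)) (w.1.adicCompletion (CyclotomicField m ℚ)) c * expStarCoordTower W' (F₀ := (Place.Completion (Sum.inr ((primesEquiv (R := 𝓞 ℚ)).symm ⟨p, hp.out⟩) : Place ℚ))) hL d ηT *
      padicLogPointFiniteExt ν (W'.baseChange (w.1.adicCompletion (CyclotomicField m ℚ))) p P)))
    (hDD : dokchitser_padicValInt_minimalDiscriminantInt_eq_of_isogeny_of_not_dvd_degree)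
    (hP1 : exists_member_sl2ZetaElement_neron_values_bar)
    (W : WeierstrassCurve ℚ) [W.IsElliptic] [W.IsGloballyMinimal] (p : ℕ) [hp : Fact p.Prime] {N : ℕ} [NeZero N]
    (D : ModularParametrizationData W N) (hN : N = W.conductorNorm ℤ) (hp57 : p = 5 ∨ p = 7) (hadd : Addv W p) (hirr : Irr W p)
    (hIstar : ∀ (v : HeightOneSpectrum ℤ) (n : ℕ), natGenerator v = p → W.kodairaSymbolAt v ≠ KodairaSymbol.Istar n)
    (h4 : 4 < padicValInt p W.minimalDiscriminantInt) (hord : p = 5 ↔ padicValInt p W.minimalDiscriminantInt = 9)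
    (hopt : ∀ z ∈ D.L.lattice, ∃ w ∈ periodLattice D.f, z = D.c * w) :
    ¬ (p : ℤ) ∣ D.c := by
  subst hN
  obtain ⟨-, hPT, hpN, ha⟩ := cell_sideFacts W p hp57 hadd h4
  refine not_dvd_c_of_tameTwist57_at hp57 W ?_ D hopt hPT hadd hirr hpN ha
  intro M _ g hg hp5' hng hnm hirr' m _ hcop hcl χ hχ hχ1 hord' ϖ r
  refine katoNeronBody_of_sl2NeronValuesBar_of_rangeAt cupLogInjective_and_hasDualExp_of_isDeRham_holds hP1 W p
    ?_ g hg hp5' hng hnm hirr' m hcop ?_ hcl χ hχ hχ1 hord' ϖ r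
  · intro v hpv _ _ _ hp' _
    exact isDeRham_restrictedRationalTateRep_adicCompletion_rat_of_starred_fiveSeven_ordinary W p hp57 hadd hIstar h4 hord
      v hpv hp'
  · intro W' _ _ hiso w hw _ _ _ hL
    -- the cell data pass to the member `W′` along the isogeny (Dokchitser–Dokchitser for `ord_p Δ_min`)
    obtain ⟨hadd', hirr', hIstar', hΔ⟩ :=
      StarredOptimalManinUnitFiveSevenCellDataOfIsogenous.cellData_of_isIsogenous hDD hiso hp57 hadd hirr hIstar
    have h4' : 4 < padicValInt p W'.minimalDiscriminantInt := hΔ ▸ h4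
    have hsel' : (p = 5 ↔ padicValInt p W'.minimalDiscriminantInt = 9) := by rw [← hΔ]; exact hord
    letI := LocalField.adicCompletionPadicAlgebra w.1 p hw
    letI : Algebra (Place.Completion (K := ℚ) (Sum.inr ((primesEquiv (R := 𝓞 ℚ)).symm ⟨p, hp.out⟩)))
        (w.1.adicCompletion (CyclotomicField m ℚ)) :=
      inferInstanceAs (Algebra (((primesEquiv (R := 𝓞 ℚ)).symm ⟨p, hp.out⟩).adicCompletion ℚ)
        (w.1.adicCompletion (CyclotomicField m ℚ)))
    exact rangeAt_of_recTowerAt W' p ((primesEquiv (R := 𝓞 ℚ)).symm ⟨p, hp.out⟩) hL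
      (hRECordI W' p hp57 hadd' hirr' hIstar' h4' hsel' m (KatoAssemblySocket.not_dvd_of_coprime_mul hcop) w hw hL)

/-- ★★ **K★ on the three potentially SUPERSINGULAR starred cells `(5; IV*), (5; II*), (7; III*)` GRANTED ONLY P1-bar and [REC-tower] AT THE
CELLS' TOWERS** (de Rham input: the tree's explicit-model capstone `explicitCapstone_holds` through `isDeRham_supersingularCells_of_explicitCapstone`).
The supersingular branch of `…CellsOfSL2NeronValuesBar.starredOptimalManinUnitFiveSeven_of_sl2NeronValuesBar_of_explicitCapstone` with hT₂ replaced by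
`hRECssI` (the body of [REC-tower] for every globally minimal curve `W′` in the cell — intrinsic — at every tower `ℚ_v ⊆ ℚ(ζ_m)_w`, `p ∤ m`) and `hDD`. CONDITIONAL; nothing is closed.
[cite: DokchitserDokchitser2015LocalInvariants, Thm. 5.1 (1)]
[cite: Kato2004Asterisque, (8.1.3) (p. 180), Thm. 9.7 (p. 189)] [cite: Kato1993LNM1553, Ch. II Thm. 1.4.1 (3)–(4)]
[cite: Fontaine1982FormesDifferentielles, §5] [cite: EdixhovenManin1991, Thm. 3] -/
theorem starredOptimalManinUnit_supersingularCells_of_recTowerAtIntrinsic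
    (hRECssI : ∀ (W' : WeierstrassCurve ℚ) [W'.IsElliptic] [W'.IsGloballyMinimal] (p : ℕ) [hp : Fact p.Prime], (p = 5 ∨ p = 7) → Addv W' p → Irr W' p →
      (∀ (v : HeightOneSpectrum ℤ) (n : ℕ), natGenerator v = p → W'.kodairaSymbolAt v ≠ KodairaSymbol.Istar n) →
      4 < padicValInt p W'.minimalDiscriminantInt → ¬ (p = 5 ↔ padicValInt p W'.minimalDiscriminantInt = 9) → ∀ (m : ℕ) [NeZero m], ¬ p ∣ m →
      ∀ (w : ((primesEquiv (R := 𝓞 ℚ)).symm ⟨p, hp.out⟩).Extension (𝓞 (CyclotomicField m ℚ))) (hw : ((p : ℕ) : 𝓞 (CyclotomicField m ℚ)) ∈ w.1.asIdeal)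
      [CharZero (w.1.adicCompletion (CyclotomicField m ℚ))] [Fact (¬ IsUnit ((p : ℕ) : integerC (w.1.adicCompletion (CyclotomicField m ℚ))))]
      [IsAdicComplete (Ideal.span {((p : ℕ) : integerC (w.1.adicCompletion (CyclotomicField m ℚ)))}) (integerC (w.1.adicCompletion (CyclotomicField m ℚ)))]
      (hL : valuation (w.1.adicCompletion (CyclotomicField m ℚ)) ((p : ℕ) : (w.1.adicCompletion (CyclotomicField m ℚ))) < 1), letI := LocalField.adicCompletionPadicAlgebra w.1 p hw
      letI : Algebra (Place.Completion (K := ℚ) (Sum.inr ((primesEquiv (R := 𝓞 ℚ)).symm ⟨p, hp.out⟩))) (w.1.adicCompletion (CyclotomicField m ℚ)) :=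
      inferInstanceAs (Algebra (((primesEquiv (R := 𝓞 ℚ)).symm ⟨p, hp.out⟩).adicCompletion ℚ) (w.1.adicCompletion (CyclotomicField m ℚ)))
      ∀ (wv : Valuation (Place.Completion (Sum.inr ((primesEquiv (R := 𝓞 ℚ)).symm ⟨p, hp.out⟩) : Place ℚ)) ℝ≥0) [wv.Compatible]
      [(W'.baseChange (Place.Completion (Sum.inr ((primesEquiv (R := 𝓞 ℚ)).symm ⟨p, hp.out⟩) : Place ℚ))).IsIntegral wv.integer]
      (ν : Valuation (w.1.adicCompletion (CyclotomicField m ℚ)) ℝ≥0) [ν.Compatible] [(W'.baseChange (w.1.adicCompletion (CyclotomicField m ℚ))).IsIntegral ν.integer]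
      (e : (k : ℕ) → geomTorsion W' ((p ^ k : ℕ) : ℤ) → geomTorsion W' ((p ^ k : ℕ) : ℤ) → AlgebraicClosure ℚ) (hμ : ∀ k S T, e k S T ^ (p ^ k) = 1)
      (hadd₁ : ∀ k S₁ S₂ T, e k (S₁ + S₂) T = e k S₁ T * e k S₂ T) (hadd₂ : ∀ k S T₁ T₂, e k S (T₁ + T₂) = e k S T₁ * e k S T₂)
      (hgal : ∀ k (σ : absoluteGaloisGroup ℚ) (S T : geomTorsion W' ((p ^ k : ℕ) : ℤ)), σ • e k S T = e k (σ • S) (σ • T))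
      (_hnondeg : ∀ k (T : geomTorsion W' ((p ^ k : ℕ) : ℤ)), (∀ S, e k S T = 1) → T = 0) (hcompat : ∀ k (S T : geomTorsion W' ((p ^ (k + 1) : ℕ) : ℤ)),
      e k (torsionMulHom W' (p ^ (k + 1)) (p ^ k) p (pow_succ p k).symm S) (torsionMulHom W' (p ^ (k + 1)) (p ^ k) p (pow_succ p k).symm T) = e (k + 1) S T ^ p)
      (d₀ : LocalNeronLineAt W' p ((primesEquiv (R := 𝓞 ℚ)).symm ⟨p, hp.out⟩)) (d : LocalNeronLine W' hL ((galRestrictPlace ((primesEquiv (R := 𝓞 ℚ)).symm ⟨p, hp.out⟩)).comp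
      (absGaloisRestrict (Place.Completion (Sum.inr ((primesEquiv (R := 𝓞 ℚ)).symm ⟨p, hp.out⟩) : Place ℚ)) (w.1.adicCompletion (CyclotomicField m ℚ))))),
      (bdRPeriodRingData (valuation_place_lt_one p ((primesEquiv (R := 𝓞 ℚ)).symm ⟨p, hp.out⟩))).CupLogInjective (logCyclotomic p)
      (localRationalTateRep W' p (galRestrictPlace ((primesEquiv (R := 𝓞 ℚ)).symm ⟨p, hp.out⟩))) →
      (∀ z : contOneCocycles (localRationalTateRep W' p (galRestrictPlace ((primesEquiv (R := 𝓞 ℚ)).symm ⟨p, hp.out⟩))).toTopRep,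
      (bdRPeriodRingData (valuation_place_lt_one p ((primesEquiv (R := 𝓞 ℚ)).symm ⟨p, hp.out⟩))).HasDualExp (logCyclotomic p)
      (localRationalTateRep W' p (galRestrictPlace ((primesEquiv (R := 𝓞 ℚ)).symm ⟨p, hp.out⟩))) fun σ => z.1 σ) →
      (bdRPeriodRingData (F := (w.1.adicCompletion (CyclotomicField m ℚ))) (p := p) hL).CupLogInjective (logCyclotomic p) (localRationalTateRep W' p
      ((galRestrictPlace ((primesEquiv (R := 𝓞 ℚ)).symm ⟨p, hp.out⟩)).comp (absGaloisRestrict (Place.Completion (Sum.inr ((primesEquiv (R := 𝓞 ℚ)).symm ⟨p, hp.out⟩) : Place ℚ)) (w.1.adicCompletion (CyclotomicField m ℚ))))) →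
      (∀ z : contOneCocycles (localRationalTateRep W' p
      ((galRestrictPlace ((primesEquiv (R := 𝓞 ℚ)).symm ⟨p, hp.out⟩)).comp (absGaloisRestrict (Place.Completion (Sum.inr ((primesEquiv (R := 𝓞 ℚ)).symm ⟨p, hp.out⟩) : Place ℚ)) (w.1.adicCompletion (CyclotomicField m ℚ))))).toTopRep,
      (bdRPeriodRingData (F := (w.1.adicCompletion (CyclotomicField m ℚ))) (p := p) hL).HasDualExp (logCyclotomic p) (localRationalTateRep W' p
      ((galRestrictPlace ((primesEquiv (R := 𝓞 ℚ)).symm ⟨p, hp.out⟩)).comp (absGaloisRestrict (Place.Completion (Sum.inr ((primesEquiv (R := 𝓞 ℚ)).symm ⟨p, hp.out⟩) : Place ℚ)) (w.1.adicCompletion (CyclotomicField m ℚ)))))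
      fun σ => z.1 σ) → (∀ (η₀ : contOneCocycles (restrictedTateRep W' (Place.Completion (Sum.inr ((primesEquiv (R := 𝓞 ℚ)).symm ⟨p, hp.out⟩) : Place ℚ)) p).toTopRep)
      (ηT : contOneCocycles ((restrictedTateRep W' (Place.Completion (Sum.inr ((primesEquiv (R := 𝓞 ℚ)).symm ⟨p, hp.out⟩) : Place ℚ)) p).restrict
      (absGaloisRestrict (Place.Completion (Sum.inr ((primesEquiv (R := 𝓞 ℚ)).symm ⟨p, hp.out⟩) : Place ℚ)) (w.1.adicCompletion (CyclotomicField m ℚ)))).toTopRep),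
      (∀ σ, ηT.1 σ = η₀.1 (absGaloisRestrict (Place.Completion (Sum.inr ((primesEquiv (R := 𝓞 ℚ)).symm ⟨p, hp.out⟩) : Place ℚ)) (w.1.adicCompletion (CyclotomicField m ℚ)) σ)) →
      expStarCoordTower W' (F₀ := (Place.Completion (Sum.inr ((primesEquiv (R := 𝓞 ℚ)).symm ⟨p, hp.out⟩) : Place ℚ))) hL d ηT =
      algebraMap (Place.Completion (Sum.inr ((primesEquiv (R := 𝓞 ℚ)).symm ⟨p, hp.out⟩) : Place ℚ)) (w.1.adicCompletion (CyclotomicField m ℚ))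
      (expStarCoord W' (valuation_place_lt_one p ((primesEquiv (R := 𝓞 ℚ)).symm ⟨p, hp.out⟩)) d₀ η₀)) →
      ∃ c : (Place.Completion (Sum.inr ((primesEquiv (R := 𝓞 ℚ)).symm ⟨p, hp.out⟩) : Place ℚ)), c ≠ 0 ∧
      (∀ (η₀ : contOneCocycles (restrictedTateRep W' (Place.Completion (Sum.inr ((primesEquiv (R := 𝓞 ℚ)).symm ⟨p, hp.out⟩) : Place ℚ)) p).toTopRep)
      (P : (W'.baseChange (Place.Completion (Sum.inr ((primesEquiv (R := 𝓞 ℚ)).symm ⟨p, hp.out⟩) : Place ℚ))).toAffine.Point),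
      ((tatePairingPoint W' (Place.Completion (Sum.inr ((primesEquiv (R := 𝓞 ℚ)).symm ⟨p, hp.out⟩) : Place ℚ)) p e hμ hadd₁ hadd₂ hgal hcompat (oneCocycleClass _ η₀) P : ℤ_[p]) : ℚ_[p]) =
      Algebra.trace ℚ_[p] (Place.Completion (Sum.inr ((primesEquiv (R := 𝓞 ℚ)).symm ⟨p, hp.out⟩) : Place ℚ))
      (c * expStarCoord W' (valuation_place_lt_one p ((primesEquiv (R := 𝓞 ℚ)).symm ⟨p, hp.out⟩)) d₀ η₀ *
      padicLogPointFiniteExt wv (W'.baseChange (Place.Completion (Sum.inr ((primesEquiv (R := 𝓞 ℚ)).symm ⟨p, hp.out⟩) : Place ℚ))) p P)) ∧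
      (∀ (ηT : contOneCocycles ((restrictedTateRep W' (Place.Completion (Sum.inr ((primesEquiv (R := 𝓞 ℚ)).symm ⟨p, hp.out⟩) : Place ℚ)) p).restrict
      (absGaloisRestrict (Place.Completion (Sum.inr ((primesEquiv (R := 𝓞 ℚ)).symm ⟨p, hp.out⟩) : Place ℚ)) (w.1.adicCompletion (CyclotomicField m ℚ)))).toTopRep)
      (P : (W'.baseChange (w.1.adicCompletion (CyclotomicField m ℚ))).toAffine.Point),
      ((tatePairingPointTower W' (Place.Completion (Sum.inr ((primesEquiv (R := 𝓞 ℚ)).symm ⟨p, hp.out⟩) : Place ℚ)) e hμ hadd₁ hadd₂ hgal hcompat (oneCocycleClass _ ηT) P : ℤ_[p]) : ℚ_[p]) =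
      Algebra.trace ℚ_[p] (w.1.adicCompletion (CyclotomicField m ℚ))
      (algebraMap (Place.Completion (Sum.inr ((primesEquiv (R := 𝓞 ℚ)).symm ⟨p, hp.out⟩) : Place ℚ)) (w.1.adicCompletion (CyclotomicField m ℚ)) c * expStarCoordTower W' (F₀ := (Place.Completion (Sum.inr ((primesEquiv (R := 𝓞 ℚ)).symm ⟨p, hp.out⟩) : Place ℚ))) hL d ηT *
      padicLogPointFiniteExt ν (W'.baseChange (w.1.adicCompletion (CyclotomicField m ℚ))) p P)))
    (hDD : dokchitser_padicValInt_minimalDiscriminantInt_eq_of_isogeny_of_not_dvd_degree)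
    (hP1 : exists_member_sl2ZetaElement_neron_values_bar)
    (W : WeierstrassCurve ℚ) [W.IsElliptic] [W.IsGloballyMinimal] (p : ℕ) [hp : Fact p.Prime] {N : ℕ} [NeZero N]
    (D : ModularParametrizationData W N) (hN : N = W.conductorNorm ℤ) (hp57 : p = 5 ∨ p = 7) (hadd : Addv W p) (hirr : Irr W p)
    (hIstar : ∀ (v : HeightOneSpectrum ℤ) (n : ℕ), natGenerator v = p → W.kodairaSymbolAt v ≠ KodairaSymbol.Istar n)
    (h4 : 4 < padicValInt p W.minimalDiscriminantInt) (hss : ¬ (p = 5 ↔ padicValInt p W.minimalDiscriminantInt = 9))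
    (hopt : ∀ z ∈ D.L.lattice, ∃ w ∈ periodLattice D.f, z = D.c * w) :
    ¬ (p : ℤ) ∣ D.c := by
  subst hN
  obtain ⟨-, hPT, hpN, ha⟩ := cell_sideFacts W p hp57 hadd h4
  refine not_dvd_c_of_tameTwist57_at hp57 W ?_ D hopt hPT hadd hirr hpN ha
  intro M _ g hg hp5' hng hnm hirr' m _ hcop hcl χ hχ hχ1 hord' ϖ r
  refine katoNeronBody_of_sl2NeronValuesBar_of_rangeAt cupLogInjective_and_hasDualExp_of_isDeRham_holds hP1 W p
    ?_ g hg hp5' hng hnm hirr' m hcop ?_ hcl χ hχ hχ1 hord' ϖ r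
  · intro v hpv _ _ _ hp' _
    exact isDeRham_supersingularCells_of_explicitCapstone
      StarredOptimalManinUnitFiveSevenSupersingularCellsDeRhamHolds.explicitCapstone_holds W p hp57 hadd hirr hIstar h4 hss v hpv hp'
  · intro W' _ _ hiso w hw _ _ _ hL
    -- the cell data pass to the member `W′` along the isogeny (Dokchitser–Dokchitser for `ord_p Δ_min`)
    obtain ⟨hadd', hirr', hIstar', hΔ⟩ :=
      StarredOptimalManinUnitFiveSevenCellDataOfIsogenous.cellData_of_isIsogenous hDD hiso hp57 hadd hirr hIstar
    have h4' : 4 < padicValInt p W'.minimalDiscriminantInt := hΔ ▸ h4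
    have hsel' : ¬ (p = 5 ↔ padicValInt p W'.minimalDiscriminantInt = 9) := by rw [← hΔ]; exact hss
    letI := LocalField.adicCompletionPadicAlgebra w.1 p hw
    letI : Algebra (Place.Completion (K := ℚ) (Sum.inr ((primesEquiv (R := 𝓞 ℚ)).symm ⟨p, hp.out⟩)))
        (w.1.adicCompletion (CyclotomicField m ℚ)) :=
      inferInstanceAs (Algebra (((primesEquiv (R := 𝓞 ℚ)).symm ⟨p, hp.out⟩).adicCompletion ℚ)
        (w.1.adicCompletion (CyclotomicField m ℚ)))
    exact rangeAt_of_recTowerAt W' p ((primesEquiv (R := 𝓞 ℚ)).symm ⟨p, hp.out⟩) hL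
      (hRECssI W' p hp57 hadd' hirr' hIstar' h4' hsel' m (KatoAssemblySocket.not_dvd_of_coprime_mul hcop) w hw hL)

/-- ★★★ **K★ `StarredOptimalManinUnitFiveSeven` BY NAME ⟸ {[REC-tower] INTRINSICALLY at the (G)-ordinary cells, at the supersingular cells,
Dokchitser–Dokchitser Thm. 5.1 (1), P1-bar} — and nothing else.** Composition of skeleton v8 (the REC stubs are intrinsic: every curve of the
cell, no isogeny quantifier; DD moves the cell data to Kato's member). [cite: DokchitserDokchitser2015LocalInvariants, Thm. 5.1 (1)] The composition of skeleton v7 of the line `kato_lever`: the two displayed hypotheses are the body of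
Kato's explicit reciprocity law `tatePairingPoint_eq_trace_expStar_log_tower` RESTRICTED to the members of the K★ isogeny classes and the
cyclotomic towers `ℚ_v ⊆ ℚ(ζ_m)_w` (`p ∤ m`) — both implied by the ∀-fields cite fact of skeleton v6, and exactly what the (K₂)^ram road +
`…ReciprocityTowerFromAbove` construct; P1-bar = `Kato2004.exists_member_sl2ZetaElement_neron_values_bar` (print XL). CONDITIONAL on the three
displayed hypotheses; the item is NOT closed by this; BSD is not proved. [cite: Kato2004Asterisque, (8.1.3) (p. 180), Thm. 9.7 (p. 189), Thm. 6.6 (1) (p. 163)]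
[cite: Kato1993LNM1553, Ch. II Thm. 1.4.1 (3)–(4)] [cite: Fontaine1982FormesDifferentielles, §5] [cite: EdixhovenManin1991, Thm. 3] -/
theorem starredOptimalManinUnitFiveSeven_of_recTowerAtIntrinsic
    (hRECordI : ∀ (W' : WeierstrassCurve ℚ) [W'.IsElliptic] [W'.IsGloballyMinimal] (p : ℕ) [hp : Fact p.Prime], (p = 5 ∨ p = 7) → Addv W' p → Irr W' p →
      (∀ (v : HeightOneSpectrum ℤ) (n : ℕ), natGenerator v = p → W'.kodairaSymbolAt v ≠ KodairaSymbol.Istar n) →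
      4 < padicValInt p W'.minimalDiscriminantInt → (p = 5 ↔ padicValInt p W'.minimalDiscriminantInt = 9) → ∀ (m : ℕ) [NeZero m], ¬ p ∣ m →
      ∀ (w : ((primesEquiv (R := 𝓞 ℚ)).symm ⟨p, hp.out⟩).Extension (𝓞 (CyclotomicField m ℚ))) (hw : ((p : ℕ) : 𝓞 (CyclotomicField m ℚ)) ∈ w.1.asIdeal)
      [CharZero (w.1.adicCompletion (CyclotomicField m ℚ))] [Fact (¬ IsUnit ((p : ℕ) : integerC (w.1.adicCompletion (CyclotomicField m ℚ))))]
      [IsAdicComplete (Ideal.span {((p : ℕ) : integerC (w.1.adicCompletion (CyclotomicField m ℚ)))}) (integerC (w.1.adicCompletion (CyclotomicField m ℚ)))]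
      (hL : valuation (w.1.adicCompletion (CyclotomicField m ℚ)) ((p : ℕ) : (w.1.adicCompletion (CyclotomicField m ℚ))) < 1), letI := LocalField.adicCompletionPadicAlgebra w.1 p hw
      letI : Algebra (Place.Completion (K := ℚ) (Sum.inr ((primesEquiv (R := 𝓞 ℚ)).symm ⟨p, hp.out⟩))) (w.1.adicCompletion (CyclotomicField m ℚ)) :=
      inferInstanceAs (Algebra (((primesEquiv (R := 𝓞 ℚ)).symm ⟨p, hp.out⟩).adicCompletion ℚ) (w.1.adicCompletion (CyclotomicField m ℚ)))
      ∀ (wv : Valuation (Place.Completion (Sum.inr ((primesEquiv (R := 𝓞 ℚ)).symm ⟨p, hp.out⟩) : Place ℚ)) ℝ≥0) [wv.Compatible]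
      [(W'.baseChange (Place.Completion (Sum.inr ((primesEquiv (R := 𝓞 ℚ)).symm ⟨p, hp.out⟩) : Place ℚ))).IsIntegral wv.integer]
      (ν : Valuation (w.1.adicCompletion (CyclotomicField m ℚ)) ℝ≥0) [ν.Compatible] [(W'.baseChange (w.1.adicCompletion (CyclotomicField m ℚ))).IsIntegral ν.integer]
      (e : (k : ℕ) → geomTorsion W' ((p ^ k : ℕ) : ℤ) → geomTorsion W' ((p ^ k : ℕ) : ℤ) → AlgebraicClosure ℚ) (hμ : ∀ k S T, e k S T ^ (p ^ k) = 1)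
      (hadd₁ : ∀ k S₁ S₂ T, e k (S₁ + S₂) T = e k S₁ T * e k S₂ T) (hadd₂ : ∀ k S T₁ T₂, e k S (T₁ + T₂) = e k S T₁ * e k S T₂)
      (hgal : ∀ k (σ : absoluteGaloisGroup ℚ) (S T : geomTorsion W' ((p ^ k : ℕ) : ℤ)), σ • e k S T = e k (σ • S) (σ • T))
      (_hnondeg : ∀ k (T : geomTorsion W' ((p ^ k : ℕ) : ℤ)), (∀ S, e k S T = 1) → T = 0) (hcompat : ∀ k (S T : geomTorsion W' ((p ^ (k + 1) : ℕ) : ℤ)),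
      e k (torsionMulHom W' (p ^ (k + 1)) (p ^ k) p (pow_succ p k).symm S) (torsionMulHom W' (p ^ (k + 1)) (p ^ k) p (pow_succ p k).symm T) = e (k + 1) S T ^ p)
      (d₀ : LocalNeronLineAt W' p ((primesEquiv (R := 𝓞 ℚ)).symm ⟨p, hp.out⟩)) (d : LocalNeronLine W' hL ((galRestrictPlace ((primesEquiv (R := 𝓞 ℚ)).symm ⟨p, hp.out⟩)).comp
      (absGaloisRestrict (Place.Completion (Sum.inr ((primesEquiv (R := 𝓞 ℚ)).symm ⟨p, hp.out⟩) : Place ℚ)) (w.1.adicCompletion (CyclotomicField m ℚ))))),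
      (bdRPeriodRingData (valuation_place_lt_one p ((primesEquiv (R := 𝓞 ℚ)).symm ⟨p, hp.out⟩))).CupLogInjective (logCyclotomic p)
      (localRationalTateRep W' p (galRestrictPlace ((primesEquiv (R := 𝓞 ℚ)).symm ⟨p, hp.out⟩))) →
      (∀ z : contOneCocycles (localRationalTateRep W' p (galRestrictPlace ((primesEquiv (R := 𝓞 ℚ)).symm ⟨p, hp.out⟩))).toTopRep,
      (bdRPeriodRingData (valuation_place_lt_one p ((primesEquiv (R := 𝓞 ℚ)).symm ⟨p, hp.out⟩))).HasDualExp (logCyclotomic p)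
      (localRationalTateRep W' p (galRestrictPlace ((primesEquiv (R := 𝓞 ℚ)).symm ⟨p, hp.out⟩))) fun σ => z.1 σ) →
      (bdRPeriodRingData (F := (w.1.adicCompletion (CyclotomicField m ℚ))) (p := p) hL).CupLogInjective (logCyclotomic p) (localRationalTateRep W' p
      ((galRestrictPlace ((primesEquiv (R := 𝓞 ℚ)).symm ⟨p, hp.out⟩)).comp (absGaloisRestrict (Place.Completion (Sum.inr ((primesEquiv (R := 𝓞 ℚ)).symm ⟨p, hp.out⟩) : Place ℚ)) (w.1.adicCompletion (CyclotomicField m ℚ))))) →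
      (∀ z : contOneCocycles (localRationalTateRep W' p
      ((galRestrictPlace ((primesEquiv (R := 𝓞 ℚ)).symm ⟨p, hp.out⟩)).comp (absGaloisRestrict (Place.Completion (Sum.inr ((primesEquiv (R := 𝓞 ℚ)).symm ⟨p, hp.out⟩) : Place ℚ)) (w.1.adicCompletion (CyclotomicField m ℚ))))).toTopRep,
      (bdRPeriodRingData (F := (w.1.adicCompletion (CyclotomicField m ℚ))) (p := p) hL).HasDualExp (logCyclotomic p) (localRationalTateRep W' p
      ((galRestrictPlace ((primesEquiv (R := 𝓞 ℚ)).symm ⟨p, hp.out⟩)).comp (absGaloisRestrict (Place.Completion (Sum.inr ((primesEquiv (R := 𝓞 ℚ)).symm ⟨p, hp.out⟩) : Place ℚ)) (w.1.adicCompletion (CyclotomicField m ℚ)))))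
      fun σ => z.1 σ) → (∀ (η₀ : contOneCocycles (restrictedTateRep W' (Place.Completion (Sum.inr ((primesEquiv (R := 𝓞 ℚ)).symm ⟨p, hp.out⟩) : Place ℚ)) p).toTopRep)
      (ηT : contOneCocycles ((restrictedTateRep W' (Place.Completion (Sum.inr ((primesEquiv (R := 𝓞 ℚ)).symm ⟨p, hp.out⟩) : Place ℚ)) p).restrict
      (absGaloisRestrict (Place.Completion (Sum.inr ((primesEquiv (R := 𝓞 ℚ)).symm ⟨p, hp.out⟩) : Place ℚ)) (w.1.adicCompletion (CyclotomicField m ℚ)))).toTopRep),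
      (∀ σ, ηT.1 σ = η₀.1 (absGaloisRestrict (Place.Completion (Sum.inr ((primesEquiv (R := 𝓞 ℚ)).symm ⟨p, hp.out⟩) : Place ℚ)) (w.1.adicCompletion (CyclotomicField m ℚ)) σ)) →
      expStarCoordTower W' (F₀ := (Place.Completion (Sum.inr ((primesEquiv (R := 𝓞 ℚ)).symm ⟨p, hp.out⟩) : Place ℚ))) hL d ηT =
      algebraMap (Place.Completion (Sum.inr ((primesEquiv (R := 𝓞 ℚ)).symm ⟨p, hp.out⟩) : Place ℚ)) (w.1.adicCompletion (CyclotomicField m ℚ))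
      (expStarCoord W' (valuation_place_lt_one p ((primesEquiv (R := 𝓞 ℚ)).symm ⟨p, hp.out⟩)) d₀ η₀)) →
      ∃ c : (Place.Completion (Sum.inr ((primesEquiv (R := 𝓞 ℚ)).symm ⟨p, hp.out⟩) : Place ℚ)), c ≠ 0 ∧
      (∀ (η₀ : contOneCocycles (restrictedTateRep W' (Place.Completion (Sum.inr ((primesEquiv (R := 𝓞 ℚ)).symm ⟨p, hp.out⟩) : Place ℚ)) p).toTopRep)
      (P : (W'.baseChange (Place.Completion (Sum.inr ((primesEquiv (R := 𝓞 ℚ)).symm ⟨p, hp.out⟩) : Place ℚ))).toAffine.Point),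
      ((tatePairingPoint W' (Place.Completion (Sum.inr ((primesEquiv (R := 𝓞 ℚ)).symm ⟨p, hp.out⟩) : Place ℚ)) p e hμ hadd₁ hadd₂ hgal hcompat (oneCocycleClass _ η₀) P : ℤ_[p]) : ℚ_[p]) =
      Algebra.trace ℚ_[p] (Place.Completion (Sum.inr ((primesEquiv (R := 𝓞 ℚ)).symm ⟨p, hp.out⟩) : Place ℚ))
      (c * expStarCoord W' (valuation_place_lt_one p ((primesEquiv (R := 𝓞 ℚ)).symm ⟨p, hp.out⟩)) d₀ η₀ *
      padicLogPointFiniteExt wv (W'.baseChange (Place.Completion (Sum.inr ((primesEquiv (R := 𝓞 ℚ)).symm ⟨p, hp.out⟩) : Place ℚ))) p P)) ∧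
      (∀ (ηT : contOneCocycles ((restrictedTateRep W' (Place.Completion (Sum.inr ((primesEquiv (R := 𝓞 ℚ)).symm ⟨p, hp.out⟩) : Place ℚ)) p).restrict
      (absGaloisRestrict (Place.Completion (Sum.inr ((primesEquiv (R := 𝓞 ℚ)).symm ⟨p, hp.out⟩) : Place ℚ)) (w.1.adicCompletion (CyclotomicField m ℚ)))).toTopRep)
      (P : (W'.baseChange (w.1.adicCompletion (CyclotomicField m ℚ))).toAffine.Point),
      ((tatePairingPointTower W' (Place.Completion (Sum.inr ((primesEquiv (R := 𝓞 ℚ)).symm ⟨p, hp.out⟩) : Place ℚ)) e hμ hadd₁ hadd₂ hgal hcompat (oneCocycleClass _ ηT) P : ℤ_[p]) : ℚ_[p]) =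
      Algebra.trace ℚ_[p] (w.1.adicCompletion (CyclotomicField m ℚ))
      (algebraMap (Place.Completion (Sum.inr ((primesEquiv (R := 𝓞 ℚ)).symm ⟨p, hp.out⟩) : Place ℚ)) (w.1.adicCompletion (CyclotomicField m ℚ)) c * expStarCoordTower W' (F₀ := (Place.Completion (Sum.inr ((primesEquiv (R := 𝓞 ℚ)).symm ⟨p, hp.out⟩) : Place ℚ))) hL d ηT *
      padicLogPointFiniteExt ν (W'.baseChange (w.1.adicCompletion (CyclotomicField m ℚ))) p P)))
    (hRECssI : ∀ (W' : WeierstrassCurve ℚ) [W'.IsElliptic] [W'.IsGloballyMinimal] (p : ℕ) [hp : Fact p.Prime], (p = 5 ∨ p = 7) → Addv W' p → Irr W' p →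
      (∀ (v : HeightOneSpectrum ℤ) (n : ℕ), natGenerator v = p → W'.kodairaSymbolAt v ≠ KodairaSymbol.Istar n) →
      4 < padicValInt p W'.minimalDiscriminantInt → ¬ (p = 5 ↔ padicValInt p W'.minimalDiscriminantInt = 9) → ∀ (m : ℕ) [NeZero m], ¬ p ∣ m →
      ∀ (w : ((primesEquiv (R := 𝓞 ℚ)).symm ⟨p, hp.out⟩).Extension (𝓞 (CyclotomicField m ℚ))) (hw : ((p : ℕ) : 𝓞 (CyclotomicField m ℚ)) ∈ w.1.asIdeal)
      [CharZero (w.1.adicCompletion (CyclotomicField m ℚ))] [Fact (¬ IsUnit ((p : ℕ) : integerC (w.1.adicCompletion (CyclotomicField m ℚ))))]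
      [IsAdicComplete (Ideal.span {((p : ℕ) : integerC (w.1.adicCompletion (CyclotomicField m ℚ)))}) (integerC (w.1.adicCompletion (CyclotomicField m ℚ)))]
      (hL : valuation (w.1.adicCompletion (CyclotomicField m ℚ)) ((p : ℕ) : (w.1.adicCompletion (CyclotomicField m ℚ))) < 1), letI := LocalField.adicCompletionPadicAlgebra w.1 p hw
      letI : Algebra (Place.Completion (K := ℚ) (Sum.inr ((primesEquiv (R := 𝓞 ℚ)).symm ⟨p, hp.out⟩))) (w.1.adicCompletion (CyclotomicField m ℚ)) :=
      inferInstanceAs (Algebra (((primesEquiv (R := 𝓞 ℚ)).symm ⟨p, hp.out⟩).adicCompletion ℚ) (w.1.adicCompletion (CyclotomicField m ℚ)))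
      ∀ (wv : Valuation (Place.Completion (Sum.inr ((primesEquiv (R := 𝓞 ℚ)).symm ⟨p, hp.out⟩) : Place ℚ)) ℝ≥0) [wv.Compatible]
      [(W'.baseChange (Place.Completion (Sum.inr ((primesEquiv (R := 𝓞 ℚ)).symm ⟨p, hp.out⟩) : Place ℚ))).IsIntegral wv.integer]
      (ν : Valuation (w.1.adicCompletion (CyclotomicField m ℚ)) ℝ≥0) [ν.Compatible] [(W'.baseChange (w.1.adicCompletion (CyclotomicField m ℚ))).IsIntegral ν.integer]
      (e : (k : ℕ) → geomTorsion W' ((p ^ k : ℕ) : ℤ) → geomTorsion W' ((p ^ k : ℕ) : ℤ) → AlgebraicClosure ℚ) (hμ : ∀ k S T, e k S T ^ (p ^ k) = 1)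
      (hadd₁ : ∀ k S₁ S₂ T, e k (S₁ + S₂) T = e k S₁ T * e k S₂ T) (hadd₂ : ∀ k S T₁ T₂, e k S (T₁ + T₂) = e k S T₁ * e k S T₂)
      (hgal : ∀ k (σ : absoluteGaloisGroup ℚ) (S T : geomTorsion W' ((p ^ k : ℕ) : ℤ)), σ • e k S T = e k (σ • S) (σ • T))
      (_hnondeg : ∀ k (T : geomTorsion W' ((p ^ k : ℕ) : ℤ)), (∀ S, e k S T = 1) → T = 0) (hcompat : ∀ k (S T : geomTorsion W' ((p ^ (k + 1) : ℕ) : ℤ)),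
      e k (torsionMulHom W' (p ^ (k + 1)) (p ^ k) p (pow_succ p k).symm S) (torsionMulHom W' (p ^ (k + 1)) (p ^ k) p (pow_succ p k).symm T) = e (k + 1) S T ^ p)
      (d₀ : LocalNeronLineAt W' p ((primesEquiv (R := 𝓞 ℚ)).symm ⟨p, hp.out⟩)) (d : LocalNeronLine W' hL ((galRestrictPlace ((primesEquiv (R := 𝓞 ℚ)).symm ⟨p, hp.out⟩)).comp
      (absGaloisRestrict (Place.Completion (Sum.inr ((primesEquiv (R := 𝓞 ℚ)).symm ⟨p, hp.out⟩) : Place ℚ)) (w.1.adicCompletion (CyclotomicField m ℚ))))),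
      (bdRPeriodRingData (valuation_place_lt_one p ((primesEquiv (R := 𝓞 ℚ)).symm ⟨p, hp.out⟩))).CupLogInjective (logCyclotomic p)
      (localRationalTateRep W' p (galRestrictPlace ((primesEquiv (R := 𝓞 ℚ)).symm ⟨p, hp.out⟩))) →
      (∀ z : contOneCocycles (localRationalTateRep W' p (galRestrictPlace ((primesEquiv (R := 𝓞 ℚ)).symm ⟨p, hp.out⟩))).toTopRep,
      (bdRPeriodRingData (valuation_place_lt_one p ((primesEquiv (R := 𝓞 ℚ)).symm ⟨p, hp.out⟩))).HasDualExp (logCyclotomic p)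
      (localRationalTateRep W' p (galRestrictPlace ((primesEquiv (R := 𝓞 ℚ)).symm ⟨p, hp.out⟩))) fun σ => z.1 σ) →
      (bdRPeriodRingData (F := (w.1.adicCompletion (CyclotomicField m ℚ))) (p := p) hL).CupLogInjective (logCyclotomic p) (localRationalTateRep W' p
      ((galRestrictPlace ((primesEquiv (R := 𝓞 ℚ)).symm ⟨p, hp.out⟩)).comp (absGaloisRestrict (Place.Completion (Sum.inr ((primesEquiv (R := 𝓞 ℚ)).symm ⟨p, hp.out⟩) : Place ℚ)) (w.1.adicCompletion (CyclotomicField m ℚ))))) →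
      (∀ z : contOneCocycles (localRationalTateRep W' p
      ((galRestrictPlace ((primesEquiv (R := 𝓞 ℚ)).symm ⟨p, hp.out⟩)).comp (absGaloisRestrict (Place.Completion (Sum.inr ((primesEquiv (R := 𝓞 ℚ)).symm ⟨p, hp.out⟩) : Place ℚ)) (w.1.adicCompletion (CyclotomicField m ℚ))))).toTopRep,
      (bdRPeriodRingData (F := (w.1.adicCompletion (CyclotomicField m ℚ))) (p := p) hL).HasDualExp (logCyclotomic p) (localRationalTateRep W' p
      ((galRestrictPlace ((primesEquiv (R := 𝓞 ℚ)).symm ⟨p, hp.out⟩)).comp (absGaloisRestrict (Place.Completion (Sum.inr ((primesEquiv (R := 𝓞 ℚ)).symm ⟨p, hp.out⟩) : Place ℚ)) (w.1.adicCompletion (CyclotomicField m ℚ)))))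
      fun σ => z.1 σ) → (∀ (η₀ : contOneCocycles (restrictedTateRep W' (Place.Completion (Sum.inr ((primesEquiv (R := 𝓞 ℚ)).symm ⟨p, hp.out⟩) : Place ℚ)) p).toTopRep)
      (ηT : contOneCocycles ((restrictedTateRep W' (Place.Completion (Sum.inr ((primesEquiv (R := 𝓞 ℚ)).symm ⟨p, hp.out⟩) : Place ℚ)) p).restrict
      (absGaloisRestrict (Place.Completion (Sum.inr ((primesEquiv (R := 𝓞 ℚ)).symm ⟨p, hp.out⟩) : Place ℚ)) (w.1.adicCompletion (CyclotomicField m ℚ)))).toTopRep),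
      (∀ σ, ηT.1 σ = η₀.1 (absGaloisRestrict (Place.Completion (Sum.inr ((primesEquiv (R := 𝓞 ℚ)).symm ⟨p, hp.out⟩) : Place ℚ)) (w.1.adicCompletion (CyclotomicField m ℚ)) σ)) →
      expStarCoordTower W' (F₀ := (Place.Completion (Sum.inr ((primesEquiv (R := 𝓞 ℚ)).symm ⟨p, hp.out⟩) : Place ℚ))) hL d ηT =
      algebraMap (Place.Completion (Sum.inr ((primesEquiv (R := 𝓞 ℚ)).symm ⟨p, hp.out⟩) : Place ℚ)) (w.1.adicCompletion (CyclotomicField m ℚ))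
      (expStarCoord W' (valuation_place_lt_one p ((primesEquiv (R := 𝓞 ℚ)).symm ⟨p, hp.out⟩)) d₀ η₀)) →
      ∃ c : (Place.Completion (Sum.inr ((primesEquiv (R := 𝓞 ℚ)).symm ⟨p, hp.out⟩) : Place ℚ)), c ≠ 0 ∧
      (∀ (η₀ : contOneCocycles (restrictedTateRep W' (Place.Completion (Sum.inr ((primesEquiv (R := 𝓞 ℚ)).symm ⟨p, hp.out⟩) : Place ℚ)) p).toTopRep)
      (P : (W'.baseChange (Place.Completion (Sum.inr ((primesEquiv (R := 𝓞 ℚ)).symm ⟨p, hp.out⟩) : Place ℚ))).toAffine.Point),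
      ((tatePairingPoint W' (Place.Completion (Sum.inr ((primesEquiv (R := 𝓞 ℚ)).symm ⟨p, hp.out⟩) : Place ℚ)) p e hμ hadd₁ hadd₂ hgal hcompat (oneCocycleClass _ η₀) P : ℤ_[p]) : ℚ_[p]) =
      Algebra.trace ℚ_[p] (Place.Completion (Sum.inr ((primesEquiv (R := 𝓞 ℚ)).symm ⟨p, hp.out⟩) : Place ℚ))
      (c * expStarCoord W' (valuation_place_lt_one p ((primesEquiv (R := 𝓞 ℚ)).symm ⟨p, hp.out⟩)) d₀ η₀ *
      padicLogPointFiniteExt wv (W'.baseChange (Place.Completion (Sum.inr ((primesEquiv (R := 𝓞 ℚ)).symm ⟨p, hp.out⟩) : Place ℚ))) p P)) ∧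
      (∀ (ηT : contOneCocycles ((restrictedTateRep W' (Place.Completion (Sum.inr ((primesEquiv (R := 𝓞 ℚ)).symm ⟨p, hp.out⟩) : Place ℚ)) p).restrict
      (absGaloisRestrict (Place.Completion (Sum.inr ((primesEquiv (R := 𝓞 ℚ)).symm ⟨p, hp.out⟩) : Place ℚ)) (w.1.adicCompletion (CyclotomicField m ℚ)))).toTopRep)
      (P : (W'.baseChange (w.1.adicCompletion (CyclotomicField m ℚ))).toAffine.Point),
      ((tatePairingPointTower W' (Place.Completion (Sum.inr ((primesEquiv (R := 𝓞 ℚ)).symm ⟨p, hp.out⟩) : Place ℚ)) e hμ hadd₁ hadd₂ hgal hcompat (oneCocycleClass _ ηT) P : ℤ_[p]) : ℚ_[p]) =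
      Algebra.trace ℚ_[p] (w.1.adicCompletion (CyclotomicField m ℚ))
      (algebraMap (Place.Completion (Sum.inr ((primesEquiv (R := 𝓞 ℚ)).symm ⟨p, hp.out⟩) : Place ℚ)) (w.1.adicCompletion (CyclotomicField m ℚ)) c * expStarCoordTower W' (F₀ := (Place.Completion (Sum.inr ((primesEquiv (R := 𝓞 ℚ)).symm ⟨p, hp.out⟩) : Place ℚ))) hL d ηT *
      padicLogPointFiniteExt ν (W'.baseChange (w.1.adicCompletion (CyclotomicField m ℚ))) p P)))
    (hDD : dokchitser_padicValInt_minimalDiscriminantInt_eq_of_isogeny_of_not_dvd_degree)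
    (hP1 : exists_member_sl2ZetaElement_neron_values_bar) :
    Summit.BirchSwinnertonDyer.BirchSwinnertonDyer.Theses.EdixhovenFibreFiveSeven.StarredOptimalManinUnitFiveSeven := by
  intro W _ _ p _ _ D hp57 hadd hirr hIstar h4 hopt
  by_cases hord : (p = 5 ↔ padicValInt p W.minimalDiscriminantInt = 9)
  · exact starredOptimalManinUnit_ordinaryCells_of_recTowerAtIntrinsic hRECordI hDD hP1 W p D rfl hp57 hadd hirr
      hIstar h4 hord hopt
  · exact starredOptimalManinUnit_supersingularCells_of_recTowerAtIntrinsic hRECssI hDD hP1 W p D rfl hp57 hadd hirr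
      hIstar h4 hord hopt

end Cells

end Summit.BirchSwinnertonDyer.BirchSwinnertonDyer.Theorems.StarredOptimalManinUnitFiveSevenCellsOfRecTowerAtIntrinsic

end
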